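import Mathlib
import Summits.QuantumAdvantage.QuantumAdvantage.Theorems.MobiusLadderQuadraticDigitPhasesStubFlipGood
import Summits.QuantumAdvantage.QuantumAdvantage.Theorems.MobiusLadderQuadraticDigitPhasesStubDigitFunctional

/-!
# Tame core campaign, file 1: digits, carries and input-bit flips (toward `stub_tameCore`)

Helper file of the campaign proving the registered stub `stub_tameCore` of the crux
`MobiusLadder.QuadraticDigitPhases` (stmt-QuantumAdvantage-1391), line `Sketch`.  Elementary binary
arithmetic of the map `T ↦ p·T` (`p` odd) under the input-bit flip `T ↦ T ⊕ 2^b`; Mathlib plus the landed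
siblings `…StubFlipGood` (blockwise XOR, locality of the flip) and `…StubDigitFunctional` (`bit_eq`,
`cast_half_add_odd`).

* `digit_eq`: the digit `y_j(X) = bit_j(pX)` as an element of `ZMod 2` is `⌊X/2^j⌋ + c_j(X)` with the CARRY
  `c_j(X) = ⌊p (X mod 2^j)/2^j⌋` into position `j`.
* `digit_flip`: for every input `X` (good or not), `y_j(X ⊕ 2^b) = y_j(X) + Δ_j` with `Δ_j = 0` below `b`,
  `Δ_b = 1`, and `Δ_j = c_j(X ⊕ 2^b) + c_j(X)` above `b`; on a GOOD input (pattern confined to `[b, b+L]`)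
  the change vanishes above `b + L` (`digit_flip_good`), so the change vector is the TRUNCATED one.
* `pattern_eq`: the XOR pattern `pX ⊕ p(X ⊕ 2^b)` is `2^b · F(⌊X/2^b⌋, c_b(X))`; hence a good flip BELOW
  `b` (which preserves `c_b`, `…StubFlipGood.carry_eq_of_good`) does not change the pattern at `b`
  (`pattern_flip_below`); together with `…StubFlipGood.pattern_stable` (flips above) and the symmetry of the
  pattern under its own flip this gives the invariance of goodness and of the truncated change vectors under
  all flips of a separated family (`delta_flip_above`, `delta_flip_below`, `delta_flip_self`).
* locality: `c_j` and the truncated change vector at `b` only see `X mod 2^(b+L)` (`delta_local`), the digit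
  `y_j` only sees `X mod 2^(j+1)` (`digit_local`).
* the HALF FLIP at a pivot `m`: flipping input bit `m - 1` fixes the digits below `m - 1`, flips `y_{m-1}`, and
  changes `y_m` by `c_{m-1}... = ⌊p (X mod 2^(m-1))/2^(m-1)⌋ + (p-1)/2` (`digit_half_top`, the carry recursion
  `cast_half_add_odd`).
* masks: `⊕_{b ∈ u} 2^b = Σ_{b ∈ u} 2^b` bitwise (`testBit_mask`, `xor_mask_insert`, `xor_mask_lt`).
-/

set_option linter.dupNamespace false -- D-0017: single-problem summit ⇒ `QuantumAdvantage.QuantumAdvantage` by design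

namespace Summit.QuantumAdvantage.QuantumAdvantage.Theorems.MobiusLadderQuadraticDigitPhasesStubTameCoreDigits

open Finset
open Summit.QuantumAdvantage.QuantumAdvantage.Theorems.MobiusLadderQuadraticDigitPhasesStubFlipGood
  (xor_blocks xor_lt_two_pow_iff xor_two_pow_mod_of_le xor_two_pow_div_of_lt mul_blocks_div carry_eq_of_good
    pattern_stable testBit_mul_flip_low)
open Summit.QuantumAdvantage.QuantumAdvantage.Theorems.MobiusLadderQuadraticDigitPhasesStubDigitFunctional
  (bit_eq cast_half_add_odd)
open Summit.QuantumAdvantage.QuantumAdvantage.Theorems.MobiusLadderQuadraticDigitPhasesStubOneCutKatai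
  (mul_block_eq)

/-! ## Digits via carries -/

/-- Casting `A ⊕ 1` to `ZMod 2` flips the parity. -/
theorem cast_xor_one (A : ℕ) : ((A ^^^ 1 : ℕ) : ZMod 2) = (A : ZMod 2) + 1 := by
  rw [← ZMod.natCast_mod (A ^^^ 1) 2, Nat.xor_mod_two_eq, ZMod.natCast_mod, Nat.cast_add, Nat.cast_one]

/-- The digit `bit_j(pX)` (as an element of `ZMod 2`) equals `⌊X/2^j⌋ + ⌊p (X mod 2^j)/2^j⌋` for odd `p`:
the input bit at `j` plus the carry into position `j`. -/
theorem digit_eq (p X j : ℕ) (hp : Odd p) :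
    (if Nat.testBit (p * X) j then (1 : ZMod 2) else 0) =
      ((X / 2 ^ j : ℕ) : ZMod 2) + ((p * (X % 2 ^ j) / 2 ^ j : ℕ) : ZMod 2) := by
  rw [bit_eq]
  conv_lhs => rw [← Nat.div_add_mod X (2 ^ j), mul_blocks_div p j (X / 2 ^ j) (X % 2 ^ j)]
  rw [Nat.cast_add, Nat.cast_mul, (ZMod.natCast_eq_one_iff_odd (n := p)).mpr hp, one_mul]

/-- The digit `bit_j(pX)` only depends on `X mod 2^(j+1)`. -/
theorem digit_local (p X X' j : ℕ) (h : X % 2 ^ (j + 1) = X' % 2 ^ (j + 1)) :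
    (if Nat.testBit (p * X) j then (1 : ZMod 2) else 0) =
      (if Nat.testBit (p * X') j then (1 : ZMod 2) else 0) := by
  have h1 : ∀ x, p * x % 2 ^ (j + 1) = p * (x % 2 ^ (j + 1)) % 2 ^ (j + 1) := fun x => by
    rw [Nat.mul_mod, Nat.mul_mod p (x % 2 ^ (j + 1)), Nat.mod_mod]
  have h2 : ∀ x, Nat.testBit (p * x) j = Nat.testBit ((p * (x % 2 ^ (j + 1))) % 2 ^ (j + 1)) j := fun x => by
    rw [← h1, Nat.testBit_mod_two_pow]
    simp
  rw [h2 X, h2 X', h]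

/-- UNIVERSAL FLIP FORMULA: for odd `p` and every input `X`, flipping the input bit `b` changes the digit
`bit_j(pX)` by `0` for `j < b`, by `1` for `j = b`, and by the carry difference
`c_j(X ⊕ 2^b) + c_j(X)` (`c_j(X) = ⌊p (X mod 2^j)/2^j⌋`) for `j > b`. -/
theorem digit_flip (p b X j : ℕ) (hp : Odd p) :
    (if Nat.testBit (p * (X ^^^ 2 ^ b)) j then (1 : ZMod 2) else 0) =
      (if Nat.testBit (p * X) j then (1 : ZMod 2) else 0) +
        (if j < b then 0 else if j = b then 1 else
          ((p * ((X ^^^ 2 ^ b) % 2 ^ j) / 2 ^ j : ℕ) : ZMod 2) + ((p * (X % 2 ^ j) / 2 ^ j : ℕ) : ZMod 2)) := by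
  by_cases hjb : j < b
  · rw [if_pos hjb, add_zero, testBit_mul_flip_low p X b j hjb]
  rw [if_neg hjb]
  by_cases hje : j = b
  · subst hje
    rw [if_pos rfl, digit_eq p _ j hp, digit_eq p X j hp, xor_two_pow_mod_of_le X le_rfl,
      Nat.xor_div_two_pow, Nat.div_self (Nat.two_pow_pos j), cast_xor_one]
    ring
  · have hbj : b < j := by omega
    rw [if_neg hje, digit_eq p _ j hp, digit_eq p X j hp, xor_two_pow_div_of_lt X hbj]
    have := CharTwo.add_self_eq_zero ((p * (X % 2 ^ j) / 2 ^ j : ℕ) : ZMod 2)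
    linear_combination -this

/-- TRUNCATED FLIP FORMULA on good inputs: if the pattern `pX ⊕ p(X ⊕ 2^b)` is confined below bit
`b + L + 1`, the digit change is the truncated change vector
`Δ_j = [j = b] + [b < j ≤ b + L] (c_j(X ⊕ 2^b) + c_j(X))`. -/
theorem digit_flip_good (p b L X j : ℕ) (hp : Odd p)
    (hgood : (p * X) ^^^ (p * (X ^^^ 2 ^ b)) < 2 ^ (b + L + 1)) :
    (if Nat.testBit (p * (X ^^^ 2 ^ b)) j then (1 : ZMod 2) else 0) =
      (if Nat.testBit (p * X) j then (1 : ZMod 2) else 0) +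
        (if j = b then 1 else if b < j ∧ j ≤ b + L then
          ((p * ((X ^^^ 2 ^ b) % 2 ^ j) / 2 ^ j : ℕ) : ZMod 2) + ((p * (X % 2 ^ j) / 2 ^ j : ℕ) : ZMod 2)
          else 0) := by
  rw [digit_flip p b X j hp]
  congr 1
  by_cases hjb : j < b
  · rw [if_pos hjb, if_neg (by omega), if_neg (by omega)]
  rw [if_neg hjb]
  by_cases hje : j = b
  · rw [if_pos hje, if_pos hje]
  rw [if_neg hje, if_neg hje]
  by_cases hjL : j ≤ b + L
  · rw [if_pos ⟨by omega, hjL⟩]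
  · rw [if_neg (fun h => hjL h.2), ← carry_eq_of_good p X b j (b + L + 1) (by omega) (by omega) hgood,
      CharTwo.add_self_eq_zero]

/-! ## The pattern in block form; goodness under other flips -/

/-- The XOR pattern of the flip at `b` in block form: it is `2^b` times a function of the high part
`⌊X/2^b⌋` and of the carry `c_b(X) = ⌊p (X mod 2^b)/2^b⌋` only. -/
theorem pattern_eq (p b X : ℕ) :
    (p * X) ^^^ (p * (X ^^^ 2 ^ b)) = 2 ^ b * ((p * (X / 2 ^ b) + p * (X % 2 ^ b) / 2 ^ b) ^^^
      (p * ((X / 2 ^ b) ^^^ 1) + p * (X % 2 ^ b) / 2 ^ b)) := by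
  have hpos : 0 < 2 ^ b := Nat.two_pow_pos b
  set H := X / 2 ^ b with hH
  set S := X % 2 ^ b with hS
  have hSl : S < 2 ^ b := Nat.mod_lt _ hpos
  have hX : X = 2 ^ b * H + S := (Nat.div_add_mod _ _).symm
  have hX' : X ^^^ 2 ^ b = 2 ^ b * (H ^^^ 1) + S := by
    have h := xor_blocks b H 1 S 0 hSl hpos
    rwa [mul_one, add_zero, Nat.xor_zero, ← hX] at h
  have hm : p * S % 2 ^ b < 2 ^ b := Nat.mod_lt _ hpos
  conv_lhs => rw [hX', hX, mul_block_eq p b H S, mul_block_eq p b (H ^^^ 1) S,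
    xor_blocks b _ _ _ _ hm hm, Nat.xor_self, add_zero]

/-- A good flip BELOW `b` does not change the pattern at `b`: if the pattern of the flip at `b' < b` lies
below `2^k` with `k ≤ b`, then `pX' ⊕ p(X' ⊕ 2^b) = pX ⊕ p(X ⊕ 2^b)` for `X' = X ⊕ 2^(b')`. -/
theorem pattern_flip_below (p X b b' k : ℕ) (hk : k ≤ b) (hb' : b' < b)
    (hgood : (p * X) ^^^ (p * (X ^^^ 2 ^ b')) < 2 ^ k) :
    (p * (X ^^^ 2 ^ b')) ^^^ (p * ((X ^^^ 2 ^ b') ^^^ 2 ^ b)) = (p * X) ^^^ (p * (X ^^^ 2 ^ b)) := by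
  rw [pattern_eq p b (X ^^^ 2 ^ b'), pattern_eq p b X, xor_two_pow_div_of_lt X hb',
    ← carry_eq_of_good p X b' b k hk hb' hgood]

/-- A flip ABOVE the window does not change the pattern: if the pattern at `b` lies below `2^(b+L+1)` and
`b + L < b'`, then it is the same for `X ⊕ 2^(b')` (this is `…StubFlipGood.pattern_stable`). -/
theorem pattern_flip_above (p X b L b' : ℕ) (hb' : b + L < b')
    (hgood : (p * X) ^^^ (p * (X ^^^ 2 ^ b)) < 2 ^ (b + L + 1)) :
    (p * (X ^^^ 2 ^ b')) ^^^ (p * ((X ^^^ 2 ^ b') ^^^ 2 ^ b)) = (p * X) ^^^ (p * (X ^^^ 2 ^ b)) :=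
  (pattern_stable p X b b' (by omega)
    (lt_of_lt_of_le hgood (Nat.pow_le_pow_right (by norm_num) (by omega)))).symm

/-- The pattern at `b` is symmetric under the flip at `b` itself. -/
theorem pattern_flip_self (p X b : ℕ) :
    (p * (X ^^^ 2 ^ b)) ^^^ (p * ((X ^^^ 2 ^ b) ^^^ 2 ^ b)) = (p * X) ^^^ (p * (X ^^^ 2 ^ b)) := by
  rw [Nat.xor_xor_cancel_right, Nat.xor_comm]

/-- GOODNESS IS STABLE along a separated family: if `X` is good at `b` and at `b'` (window length `L`) and the
two positions coincide or are more than `L` apart, then `X ⊕ 2^(b')` is still good at `b` — indeed the pattern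
at `b` is unchanged. -/
theorem pattern_flip_of_sep (p X b b' L : ℕ)
    (hgb : (p * X) ^^^ (p * (X ^^^ 2 ^ b)) < 2 ^ (b + L + 1))
    (hgb' : (p * X) ^^^ (p * (X ^^^ 2 ^ b')) < 2 ^ (b' + L + 1))
    (hsep : b = b' ∨ b + L < b' ∨ b' + L < b) :
    (p * (X ^^^ 2 ^ b')) ^^^ (p * ((X ^^^ 2 ^ b') ^^^ 2 ^ b)) = (p * X) ^^^ (p * (X ^^^ 2 ^ b)) := by
  rcases hsep with rfl | h | h
  · exact pattern_flip_self p X b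
  · exact pattern_flip_above p X b L b' h hgb
  · exact pattern_flip_below p X b b' (b' + L + 1) (by omega) (by omega) hgb'

/-! ## Locality and flip invariance of the truncated change vector -/

/-- Residues below `2^j` are determined by residues below `2^K`, `j ≤ K`. -/
theorem mod_local (X X' j K : ℕ) (hjK : j ≤ K) (h : X % 2 ^ K = X' % 2 ^ K) : X % 2 ^ j = X' % 2 ^ j := by
  rw [← Nat.mod_mod_of_dvd X (Nat.pow_dvd_pow 2 hjK), h, Nat.mod_mod_of_dvd X' (Nat.pow_dvd_pow 2 hjK)]

/-- Residues of the flipped input below `2^j` are determined by residues below `2^K`, `j ≤ K`. -/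
theorem xor_mod_local (X X' b j K : ℕ) (hjK : j ≤ K) (h : X % 2 ^ K = X' % 2 ^ K) :
    (X ^^^ 2 ^ b) % 2 ^ j = (X' ^^^ 2 ^ b) % 2 ^ j := by
  rw [Nat.xor_mod_two_pow, Nat.xor_mod_two_pow, mod_local X X' j K hjK h]

/-- LOCALITY of the truncated change vector of the flip at `b` (window `L`): it only sees `X mod 2^(b+L)`. -/
theorem delta_local (p b L X X' : ℕ) (h : X % 2 ^ (b + L) = X' % 2 ^ (b + L)) (j : ℕ) :
    (if j = b then (1 : ZMod 2) else if b < j ∧ j ≤ b + L then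
        ((p * ((X ^^^ 2 ^ b) % 2 ^ j) / 2 ^ j : ℕ) : ZMod 2) + ((p * (X % 2 ^ j) / 2 ^ j : ℕ) : ZMod 2) else 0) =
      (if j = b then (1 : ZMod 2) else if b < j ∧ j ≤ b + L then
        ((p * ((X' ^^^ 2 ^ b) % 2 ^ j) / 2 ^ j : ℕ) : ZMod 2) + ((p * (X' % 2 ^ j) / 2 ^ j : ℕ) : ZMod 2) else 0) := by
  by_cases hjb : j = b
  · rw [if_pos hjb, if_pos hjb]
  rw [if_neg hjb, if_neg hjb]
  by_cases hj : b < j ∧ j ≤ b + L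
  · rw [if_pos hj, if_pos hj, mod_local X X' j (b + L) hj.2 h, xor_mod_local X X' b j (b + L) hj.2 h]
  · rw [if_neg hj, if_neg hj]

/-- The truncated change vector at `b` is unchanged by a flip ABOVE the window (`b + L < b'`). -/
theorem delta_flip_above (p b L b' X : ℕ) (hb' : b + L < b') (j : ℕ) :
    (if j = b then (1 : ZMod 2) else if b < j ∧ j ≤ b + L then
        ((p * (((X ^^^ 2 ^ b') ^^^ 2 ^ b) % 2 ^ j) / 2 ^ j : ℕ) : ZMod 2) +
          ((p * ((X ^^^ 2 ^ b') % 2 ^ j) / 2 ^ j : ℕ) : ZMod 2) else 0) =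
      (if j = b then (1 : ZMod 2) else if b < j ∧ j ≤ b + L then
        ((p * ((X ^^^ 2 ^ b) % 2 ^ j) / 2 ^ j : ℕ) : ZMod 2) + ((p * (X % 2 ^ j) / 2 ^ j : ℕ) : ZMod 2) else 0) :=
  delta_local p b L (X ^^^ 2 ^ b') X (xor_two_pow_mod_of_le X hb'.le) j

/-- The truncated change vector at `b` is unchanged by the flip at `b` itself. -/
theorem delta_flip_self (p b L X : ℕ) (j : ℕ) :
    (if j = b then (1 : ZMod 2) else if b < j ∧ j ≤ b + L then
        ((p * (((X ^^^ 2 ^ b) ^^^ 2 ^ b) % 2 ^ j) / 2 ^ j : ℕ) : ZMod 2) +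
          ((p * ((X ^^^ 2 ^ b) % 2 ^ j) / 2 ^ j : ℕ) : ZMod 2) else 0) =
      (if j = b then (1 : ZMod 2) else if b < j ∧ j ≤ b + L then
        ((p * ((X ^^^ 2 ^ b) % 2 ^ j) / 2 ^ j : ℕ) : ZMod 2) + ((p * (X % 2 ^ j) / 2 ^ j : ℕ) : ZMod 2) else 0) := by
  rw [Nat.xor_xor_cancel_right]
  split_ifs
  · rfl
  · exact add_comm _ _
  · rfl

/-- The truncated change vector at `b` is unchanged by a GOOD flip BELOW the position (`b' + L' < b`, the
pattern at `b'` confined below `2^(b'+L'+1)`): the carries into the window agree. -/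
theorem delta_flip_below (p b L b' L' X : ℕ) (hb' : b' + L' < b)
    (hgood' : (p * X) ^^^ (p * (X ^^^ 2 ^ b')) < 2 ^ (b' + L' + 1)) (j : ℕ) :
    (if j = b then (1 : ZMod 2) else if b < j ∧ j ≤ b + L then
        ((p * (((X ^^^ 2 ^ b') ^^^ 2 ^ b) % 2 ^ j) / 2 ^ j : ℕ) : ZMod 2) +
          ((p * ((X ^^^ 2 ^ b') % 2 ^ j) / 2 ^ j : ℕ) : ZMod 2) else 0) =
      (if j = b then (1 : ZMod 2) else if b < j ∧ j ≤ b + L then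
        ((p * ((X ^^^ 2 ^ b) % 2 ^ j) / 2 ^ j : ℕ) : ZMod 2) + ((p * (X % 2 ^ j) / 2 ^ j : ℕ) : ZMod 2) else 0) := by
  by_cases hjb : j = b
  · rw [if_pos hjb, if_pos hjb]
  rw [if_neg hjb, if_neg hjb]
  by_cases hj : b < j ∧ j ≤ b + L
  · have hgood'' : (p * (X ^^^ 2 ^ b)) ^^^ (p * ((X ^^^ 2 ^ b) ^^^ 2 ^ b')) < 2 ^ (b' + L' + 1) := by
      rw [pattern_flip_above p X b' L' b hb' hgood']
      exact hgood'
    rw [if_pos hj, if_pos hj, Nat.xor_right_comm,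
      ← carry_eq_of_good p (X ^^^ 2 ^ b) b' j (b' + L' + 1) (by omega) (by omega) hgood'',
      ← carry_eq_of_good p X b' j (b' + L' + 1) (by omega) (by omega) hgood']
  · rw [if_neg hj, if_neg hj]

/-- FLIP INVARIANCE of the truncated change vector along a separated family of good positions. -/
theorem delta_flip_of_sep (p X b b' L : ℕ)
    (hgb' : (p * X) ^^^ (p * (X ^^^ 2 ^ b')) < 2 ^ (b' + L + 1))
    (hsep : b = b' ∨ b + L < b' ∨ b' + L < b) (j : ℕ) :
    (if j = b then (1 : ZMod 2) else if b < j ∧ j ≤ b + L then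
        ((p * (((X ^^^ 2 ^ b') ^^^ 2 ^ b) % 2 ^ j) / 2 ^ j : ℕ) : ZMod 2) +
          ((p * ((X ^^^ 2 ^ b') % 2 ^ j) / 2 ^ j : ℕ) : ZMod 2) else 0) =
      (if j = b then (1 : ZMod 2) else if b < j ∧ j ≤ b + L then
        ((p * ((X ^^^ 2 ^ b) % 2 ^ j) / 2 ^ j : ℕ) : ZMod 2) + ((p * (X % 2 ^ j) / 2 ^ j : ℕ) : ZMod 2) else 0) := by
  rcases hsep with rfl | h | h
  · exact delta_flip_self p b L X j
  · exact delta_flip_above p b L b' X h j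
  · exact delta_flip_below p b L b' L X h hgb' j

/-- On a good input the high quotients `⌊pX/2^K⌋`, `K > b + L`, are unchanged by the flip. -/
theorem div_eq_of_good (p X b L K : ℕ) (hK : b + L + 1 ≤ K)
    (hgood : (p * X) ^^^ (p * (X ^^^ 2 ^ b)) < 2 ^ (b + L + 1)) :
    p * (X ^^^ 2 ^ b) / 2 ^ K = p * X / 2 ^ K :=
  ((xor_lt_two_pow_iff _ _ _).mp (lt_of_lt_of_le hgood (Nat.pow_le_pow_right (by norm_num) hK))).symm

/-! ## The half flip at a pivot -/

/-- Flipping the input bit `t` does not change the digits below `t`. -/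
theorem digit_half_low (p X t j : ℕ) (hj : j < t) :
    (if Nat.testBit (p * (X ^^^ 2 ^ t)) j then (1 : ZMod 2) else 0) =
      (if Nat.testBit (p * X) j then (1 : ZMod 2) else 0) := by
  rw [testBit_mul_flip_low p X t j hj]

/-- Flipping the input bit `t` flips the digit at `t` (`p` odd). -/
theorem digit_half_mid (p X t : ℕ) (hp : Odd p) :
    (if Nat.testBit (p * (X ^^^ 2 ^ t)) t then (1 : ZMod 2) else 0) =
      (if Nat.testBit (p * X) t then (1 : ZMod 2) else 0) + 1 := by
  rw [digit_flip p t X t hp, if_neg (lt_irrefl t), if_pos rfl]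

/-- The carry into position `t + 1` in terms of the input bit `u` at `t` and the carry
`ρ = ⌊p (X mod 2^t)/2^t⌋` into position `t`: it is `⌊(p u + ρ)/2⌋`. -/
theorem carry_succ_eq (p t S u : ℕ) :
    p * (S + 2 ^ t * u) / 2 ^ (t + 1) = (p * u + p * S / 2 ^ t) / 2 := by
  rw [show p * (S + 2 ^ t * u) = 2 ^ t * (p * u) + p * S by ring, pow_succ,
    ← Nat.div_div_eq_div_mul, Nat.mul_add_div (Nat.two_pow_pos t)]

/-- Flipping the input bit `t` changes the digit at `t + 1` by `⌊p (X mod 2^t)/2^t⌋ + (p-1)/2`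
(carry recursion modulo `2`). -/
theorem digit_half_top (p p' X t : ℕ) (hp : p = 2 * p' + 1) :
    (if Nat.testBit (p * (X ^^^ 2 ^ t)) (t + 1) then (1 : ZMod 2) else 0) =
      (if Nat.testBit (p * X) (t + 1) then (1 : ZMod 2) else 0) +
        (((p * (X % 2 ^ t) / 2 ^ t : ℕ) : ZMod 2) + p') := by
  have hpo : Odd p := ⟨p', hp⟩
  have hlt : t < t + 1 := Nat.lt_succ_self t
  rw [digit_eq p _ _ hpo, digit_eq p X _ hpo, xor_two_pow_div_of_lt X hlt, Nat.mod_pow_succ,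
    Nat.mod_pow_succ, xor_two_pow_mod_of_le X le_rfl, Nat.xor_div_two_pow,
    Nat.div_self (Nat.two_pow_pos t), carry_succ_eq, carry_succ_eq, Nat.xor_mod_two_eq]
  set ρ := p * (X % 2 ^ t) / 2 ^ t with hρ
  have h2 := CharTwo.add_self_eq_zero ((ρ : ZMod 2) + p')
  rcases Nat.mod_two_eq_zero_or_one (X / 2 ^ t) with h | h
  · have h' : (X / 2 ^ t + 1) % 2 = 1 := by omega
    rw [h, h', mul_one, mul_zero, zero_add, add_comm p ρ, hp, cast_half_add_odd]
    ring
  · have h' : (X / 2 ^ t + 1) % 2 = 0 := by omega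
    rw [h, h', mul_one, mul_zero, zero_add, add_comm p ρ, hp, cast_half_add_odd]
    linear_combination -h2

/-! ## Masks: the XOR of distinct powers of two -/

/-- Adding `2^b` to a number whose bit `b` is clear is the same as XOR-ing it in. -/
theorem two_pow_add_of_testBit_false (M b : ℕ) (h : Nat.testBit M b = false) :
    2 ^ b + M = M ^^^ 2 ^ b := by
  have hE : Even (M / 2 ^ b) := by
    rw [Nat.testBit_eq_decide_div_mod_eq, decide_eq_false_iff_not] at h
    rw [Nat.even_iff]
    rcases Nat.mod_two_eq_zero_or_one (M / 2 ^ b) with h' | h'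
    · exact h'
    · exact absurd h' h
  have hdm := Nat.div_add_mod M (2 ^ b)
  conv_rhs => rw [← hdm,
    Summit.QuantumAdvantage.QuantumAdvantage.Theorems.MobiusLadderQuadraticDigitPhasesStubFlipGood.flip_even
      b (M / 2 ^ b) (M % 2 ^ b) hE (Nat.mod_lt _ (Nat.two_pow_pos b))]
  rw [mul_add, mul_one]
  omega

/-- The bits of the mask `Σ_{x ∈ u} 2^x` are the indicator of `u`. -/
theorem testBit_mask (u : Finset ℕ) : ∀ j, Nat.testBit (∑ x ∈ u, 2 ^ x) j = decide (j ∈ u) := by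
  induction u using Finset.induction_on with
  | empty => intro j; simp
  | insert b u hb ih =>
    intro j
    have hbit : Nat.testBit (∑ x ∈ u, 2 ^ x) b = false := by rw [ih]; simp [hb]
    rw [sum_insert hb, two_pow_add_of_testBit_false _ _ hbit, Nat.testBit_xor, ih, Nat.testBit_two_pow]
    by_cases hjb : j = b
    · subst hjb; simp [hb]
    · simp [hjb, Ne.symm hjb]

/-- Inserting a fresh position into the mask composes the multi-flip with the single flip. -/
theorem xor_mask_insert (T b : ℕ) (u : Finset ℕ) (hb : b ∉ u) :
    T ^^^ (∑ x ∈ insert b u, 2 ^ x) = (T ^^^ ∑ x ∈ u, 2 ^ x) ^^^ 2 ^ b := by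
  have hbit : Nat.testBit (∑ x ∈ u, 2 ^ x) b = false := by rw [testBit_mask]; simp [hb]
  rw [sum_insert hb, two_pow_add_of_testBit_false _ _ hbit, Nat.xor_assoc]

/-- A mask of positions below `N` is below `2^N`. -/
theorem mask_lt (u : Finset ℕ) (N : ℕ) (hu : ∀ x ∈ u, x < N) : ∑ x ∈ u, 2 ^ x < 2 ^ N := by
  refine Nat.lt_pow_two_of_testBit _ fun i hi => ?_
  rw [testBit_mask, decide_eq_false_iff_not]
  exact fun hi' => absurd (hu i hi') (not_lt.2 hi)

/-- The multi-flip at positions below `N` preserves `[0, 2^N)`. -/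
theorem xor_mask_lt (T N : ℕ) (u : Finset ℕ) (hT : T < 2 ^ N) (hu : ∀ x ∈ u, x < N) :
    T ^^^ ∑ x ∈ u, 2 ^ x < 2 ^ N :=
  Nat.xor_lt_two_pow hT (mask_lt u N hu)

/-- MAIN STATEMENT of this helper file (registered campaign stub toward `stub_tameCore`): the truncated flip
formula — on an input whose pattern at `b` is confined below bit `b + L + 1`, flipping the input bit `b`
changes the digit `bit_j(pX)` by `[j = b] + [b < j ≤ b + L] (c_j(X ⊕ 2^b) + c_j(X))`. -/
theorem stub_tameCoreDigits : ∀ (p b L X j : ℕ), Odd p → (p * X) ^^^ (p * (X ^^^ 2 ^ b)) < 2 ^ (b + L + 1) → (if Nat.testBit (p * (X ^^^ 2 ^ b)) j then (1 : ZMod 2) else 0) = (if Nat.testBit (p * X) j then (1 : ZMod 2) else 0) + (if j = b then 1 else if b < j ∧ j ≤ b + L then ((p * ((X ^^^ 2 ^ b) % 2 ^ j) / 2 ^ j : ℕ) : ZMod 2) + ((p * (X % 2 ^ j) / 2 ^ j : ℕ) : ZMod 2) else 0) := by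
  intro p b L X j hp hgood
  exact digit_flip_good p b L X j hp hgood

end Summit.QuantumAdvantage.QuantumAdvantage.Theorems.MobiusLadderQuadraticDigitPhasesStubTameCoreDigits
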